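import Summits.BirchSwinnertonDyer.BirchSwinnertonDyer.Theorems.CMKolyvaginAtInertTwoPairSupplyHeegnerClassAtTwo
import HarnessLib

/-!
# Route `CMKolyvaginAtInertTwo`, crux `CMKolyvaginExactAtInertTwo` (stmt-BirchSwinnertonDyer-24277):
# SUPPLIER of the two-member data, IV — **`∃ D : PairDataM` ON THE `ℚ`-PAIR `(E, E^{(d_K)})` at level `2^M`** from a
# `K`-point system of level `2^{M+1}`, in BOTH root-number branches, with the consumer's compatibilities

Seat `bsd-line-cmk2-p1` g18 (cell `bsd-print-cf2`); helper (`--supports stmt-BirchSwinnertonDyer-24277`).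
THEOREMS ONLY: no definition, no named fact, no `sorry`; no item is closed; BSD is not proved by this.

KERNEL-STATUS §17.7 / §17.14 (a): the input `D` of g17's
`KolyvaginPairDataTwo.card_primaryComponent_sha_two_baseChange_le_pow_of_pairData_cmInert_of_facts` (branch `w(E/ℚ) = −1`:
`E` first) and `D'` of `…_neg_of_facts` (branch `+1`: twin first). Given: `K = ℚ(θ)` imaginary quadratic, `θ² = d_K` odd,
`Δ(E) < 0`, a Heegner point `P` of level `N`, a `K`-point system `D'` of ty2's shape at `(2, M+1)` for `σ₀` with support
`kolPrime W K M` (file II's `Kol`), `E(K)[2^{M+1}] = 0`, `E(K)[2] = 0`, and `x₀ ∈ E(K)` with `2^{M₀} x₀ = P`, `2^{M₀+1} ∤ P`: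

* `exists_pairDataM_of_pointSystem` (`D'.ε = 1`) — `∃ D : PairDataM (H¹(ℚ,E[2^M])) (H¹(ℚ,E^{(d_K)}[2^M])) (places ℚ)` with
  `D.p = 2`, `D.M = M`, `D.Sel₁/₂ = selmerGroup`, `D.Loc₁ = loc₁ W M`, `D.Loc₂ = loc₂ W K M`, `D.A₁ = a₁ W M`, `D.A₂ = a₂ W K M`,
  `D.pl = pl`, `D.Dv = Dv`, `D.Kol ℓ ↔ IsKolyvaginPrime N W K 2 ℓ ∧ FrobEqFrobInfty W K (2^{M+1}) ℓ ∧ kolPrime W K M ℓ`, `D.M₀ = M₀`,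
  `res D.x = δ_M(x₀)`, and `D.x` DIES in `H¹(ℚ, E)`;
* `exists_pairDataM_twin_of_pointSystem` (`D'.ε = −1`) — the same with the members exchanged (`Sel₁ = Sel(E^{(d_K)})`,
  `Loc₁ = loc₂ W K M`, `A₁ = a₂ W K M`, …), `ψ(res D.x) = δ_M(x₀)`, `D.x` dies in `H¹(ℚ, E^{(d_K)})`.

Fields: classes `[2]_*` of the level-`2^{M+1}` descents (file II `exists_descent_cK`, choice), Lemma 4.3 by
`torsionH1ZSMul(_twin)_mem_loc_of_notDv`, Prop. 4.4 by `zsmul_torsionH1ZSMul_(twin_)mem_loc_iff_…`, `x` by file III;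
bookkeeping as in gk2-p3's `visiblePair`. References: [Kolyvagin1989Izv] §3; [McCallumLMS1991] §§4–5 (Lemma 4.3, Prop. 4.4,
Lemma 5.1); [GrossLMS1991] (4.4), Props. 5.3, 5.4 (2), 6.2.
-/

-- single-conjunct summit: `Summit.BirchSwinnertonDyer.BirchSwinnertonDyer.…` repeats the name by design
set_option linter.dupNamespace false
set_option autoImplicit false

noncomputable section

open scoped Classical

namespace Summit.BirchSwinnertonDyer.BirchSwinnertonDyer.Theorems.KolyvaginPairSupplyTwo

open WeierstrassCurve NumberField IsDedekindDomain Field Rat.HeightOneSpectrum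
open Literature.NumberTheory.EllipticCurves Literature.NumberTheory.GaloisRepresentations
open Literature.NumberTheory.EllipticCurves.KolyvaginDescent
open Summit.BirchSwinnertonDyer.Rank1Residual.P2.KolyvaginMachine
open Summit.BirchSwinnertonDyer.BirchSwinnertonDyer.Theorems.KolyvaginPairDataTwo
open Summit.BirchSwinnertonDyer.BirchSwinnertonDyer.Theorems.GenusExact.VisiblePairAtTwo

variable {N : ℕ} (W : WeierstrassCurve ℚ) {K : Type} [Field K] [NumberField K] (M : ℕ)
  (hdiv' : ∀ Q : geomPoints (W.baseChange K), ∃ R, (lvl (M + 1) : ℤ) • R = Q)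
  (hdivM : ∀ Q : geomPoints (W.baseChange K), ∃ R, (lvl M : ℤ) • R = Q)

/-- Parity bookkeeping for the sign `ε(−1)^{r(m)}`. [folklore] -/
theorem sign_of_even {ε : ℤ} {r : ℕ} (hr : Even r) : ε * (-1) ^ r = ε := by
  rw [hr.neg_one_pow, mul_one]

/-- Parity bookkeeping for the sign `ε(−1)^{r(m)}`. [folklore] -/
theorem sign_of_odd {ε : ℤ} {r : ℕ} (hr : Odd r) : ε * (-1) ^ r = -ε := by
  rw [hr.neg_one_pow, mul_neg_one]

/-- **Choice of the descents** (file II `exists_descent_cK`, packaged as functions): for a point system `D'` at `(2, M+1)`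
for `σ₀` with `E(K)[2^{M+1}] = 0` there are `U : ℕ → H¹(ℚ, E[2^{M+1}])`, `Y : ℕ → H¹(ℚ, E^{(d_K)}[2^{M+1}])` with
`res (U m) = c'_K(m)` whenever `ε(−1)^{r(m)} = 1` and `ψ(res (Y m)) = c'_K(m)` whenever it is `−1` (`m` square-free on the
support). [cite: GrossLMS1991, Prop. 5.4 (2) and §5 (5.1)] [cite: Kolyvagin1989Izv, §3] -/
theorem exists_descent_functions (h2 : Module.finrank ℚ K = 2) {θ : K} (hθ : θ ∉ Set.range (algebraMap ℚ K))
    (hd : θ ^ 2 = algebraMap ℚ K ((NumberField.discr K : ℤ) : ℚ)) {S : ℕ → Prop}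
    {P : (W.baseChange K).toAffine.Point} (D' : PointSystem N W K P 2 S (M + 1) hdiv' (sigmaQ K h2 hθ hd))
    (hL : ∀ Q : (W.baseChange K).toAffine.Point, (lvl (M + 1) : ℤ) • Q = 0 → Q = 0) :
    ∃ (U : ℕ → galH1Torsion W (lvl (M + 1))) (Y : ℕ → galH1Torsion (twin W K) (lvl (M + 1))),
      (∀ m, KolSupp (fun ℓ ↦ IsKolyvaginPrime N W K 2 ℓ ∧ FrobEqFrobInfty W K (2 ^ (M + 1)) ℓ ∧ S ℓ) m →
        D'.ε * (-1) ^ m.primeFactors.card = 1 →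
          resTorsion W K (lvl (M + 1)) (U m) = cK W (sigmaQ K h2 hθ hd) (M + 1) hdiv' D' m) ∧
      (∀ m, KolSupp (fun ℓ ↦ IsKolyvaginPrime N W K 2 ℓ ∧ FrobEqFrobInfty W K (2 ^ (M + 1)) ℓ ∧ S ℓ) m →
        D'.ε * (-1) ^ m.primeFactors.card = -1 →
          hPsiKT W K hθ hd (lvl (M + 1)) (resTorsion (twin W K) K (lvl (M + 1)) (Y m)) =
            cK W (sigmaQ K h2 hθ hd) (M + 1) hdiv' D' m) := by
  refine ⟨fun m ↦ if h : KolSupp (fun ℓ ↦ IsKolyvaginPrime N W K 2 ℓ ∧ FrobEqFrobInfty W K (2 ^ (M + 1)) ℓ ∧ S ℓ) m ∧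
        D'.ε * (-1) ^ m.primeFactors.card = 1 then
      Classical.choose ((exists_descent_cK W M hdiv' h2 hθ hd D' hL h.1).1 h.2) else 0,
    fun m ↦ if h : KolSupp (fun ℓ ↦ IsKolyvaginPrime N W K 2 ℓ ∧ FrobEqFrobInfty W K (2 ^ (M + 1)) ℓ ∧ S ℓ) m ∧
        D'.ε * (-1) ^ m.primeFactors.card = -1 then
      Classical.choose ((exists_descent_cK W M hdiv' h2 hθ hd D' hL h.1).2 h.2) else 0,
    fun m hm hs ↦ ?_, fun m hm hs ↦ ?_⟩
  · simp only [dif_pos (And.intro hm hs)]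
    exact Classical.choose_spec ((exists_descent_cK W M hdiv' h2 hθ hd D' hL hm).1 hs)
  · simp only [dif_pos (And.intro hm hs)]
    exact Classical.choose_spec ((exists_descent_cK W M hdiv' h2 hθ hd D' hL hm).2 hs)

/-- **THE TWO-MEMBER DESCENT DATA ON THE `ℚ`-PAIR, BRANCH `ε = 1` (`E` first; `w(E/ℚ) = −1`)** — see the module docstring.
[cite: Kolyvagin1989Izv, §3 (the pair (E, E^D) over ℚ at l = 2)] [cite: McCallumLMS1991, §§4–5 (Lemma 4.3, Prop. 4.4, Lemma 5.1)]
[cite: GrossLMS1991, (4.4), Props. 5.3, 5.4 (2), 6.2] -/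
theorem exists_pairDataM_of_pointSystem [NeZero N] [W.IsElliptic] [W.IsGloballyMinimal] [(twin W K).IsElliptic]
    (hK : IsImaginaryQuadratic K) (hodd : Odd (NumberField.discr K)) (hΔ : W.Δ < 0)
    {θ : K} (hθ : θ ∉ Set.range (algebraMap ℚ K)) (hd : θ ^ 2 = algebraMap ℚ K ((NumberField.discr K : ℤ) : ℚ))
    {P : (W.baseChange K).toAffine.Point} (hP : IsHeegnerPoint N W K P) (hM : 1 ≤ M)
    (D' : PointSystem N W K P 2 (kolPrime W K M) (M + 1) hdiv' (sigmaQ K hK.1 hθ hd)) (hε : D'.ε = 1)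
    (hL : ∀ Q : (W.baseChange K).toAffine.Point, (lvl (M + 1) : ℤ) • Q = 0 → Q = 0)
    (h2t : ∀ T : (W.baseChange K).toAffine.Point, (2 : ℤ) • T = 0 → T = 0)
    {x₀ : (W.baseChange K).toAffine.Point} {M₀ : ℕ} (hx₀ : (((2 : ℕ) : ℤ) ^ M₀) • x₀ = P)
    (hnd : ∀ Q : (W.baseChange K).toAffine.Point, (((2 : ℕ) : ℤ) ^ (M₀ + 1)) • Q ≠ P) :
    ∃ D : PairDataM (galH1Torsion W (lvl M)) (galH1Torsion (twin W K) (lvl M))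
        (HeightOneSpectrum (𝓞 ℚ) ⊕ InfinitePlace ℚ),
      D.p = 2 ∧ D.M = M ∧ D.Sel₁ = selmerGroup W (lvl M) ∧ D.Sel₂ = selmerGroup (twin W K) (lvl M) ∧
      D.Loc₁ = loc₁ W M ∧ D.Loc₂ = loc₂ W K M ∧ D.A₁ = a₁ W M ∧ D.A₂ = a₂ W K M ∧ D.pl = pl ∧ D.Dv = Dv ∧
      (∀ ℓ, D.Kol ℓ ↔ IsKolyvaginPrime N W K 2 ℓ ∧ FrobEqFrobInfty W K (2 ^ (M + 1)) ℓ ∧ kolPrime W K M ℓ) ∧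
      D.M₀ = M₀ ∧
      resTorsion W K (lvl M) D.x = kummerMapTorsion (W.baseChange K) (lvl M) hdivM x₀ ∧
      torsionH1ToH1 W (lvl M) D.x = 0 := by
  -- the Heegner class
  have htor : IsOfFinAddOrder (Affine.Point.map (W' := W) (sigmaQ K hK.1 hθ hd : K →ₐ[ℚ] K) P - (1 : ℤ) • P) := by
    have h := D'.conj_sub_torsion
    rwa [hε] at h
  obtain ⟨ξ, hξ⟩ := exists_resTorsion_eq_kummerMapTorsion W M hdiv' hK.1 hθ hd hL h2t hx₀ htor
  -- the descents
  obtain ⟨U, Y, hU, hY⟩ := exists_descent_functions W M hdiv' hK.1 hθ hd D' hL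
  have hU' : ∀ m, KolSupp (fun ℓ ↦ IsKolyvaginPrime N W K 2 ℓ ∧ FrobEqFrobInfty W K (2 ^ (M + 1)) ℓ ∧ kolPrime W K M ℓ) m →
      Even m.primeFactors.card → resTorsion W K (lvl (M + 1)) (U m) = cK W (sigmaQ K hK.1 hθ hd) (M + 1) hdiv' D' m :=
    fun m hm he ↦ hU m hm (by rw [sign_of_even he, hε])
  have hY' : ∀ m, KolSupp (fun ℓ ↦ IsKolyvaginPrime N W K 2 ℓ ∧ FrobEqFrobInfty W K (2 ^ (M + 1)) ℓ ∧ kolPrime W K M ℓ) m →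
      Odd m.primeFactors.card →
        hPsiKT W K hθ hd (lvl (M + 1)) (resTorsion (twin W K) K (lvl (M + 1)) (Y m)) = cK W (sigmaQ K hK.1 hθ hd) (M + 1) hdiv' D' m :=
    fun m hm ho ↦ hY m hm (by rw [sign_of_odd ho, hε])
  -- `U 1 = 2^{M₀} ξ`
  have hU1 : U 1 = (((2 : ℕ) : ℤ) ^ M₀) • ξ := by
    have h1 := hU' 1 (kolSupp_one _) (by simp)
    rw [cK_one_eq_kummerMapTorsion] at h1
    exact eq_zsmul_of_resTorsion_eq W M hdiv' hK.1 hθ hd hL hx₀ h1 hξ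
  refine ⟨{ p := 2
            hp := Nat.prime_two
            M := M
            torsion₁ := fun v ↦ by
              have h : ((2 ^ M : ℕ) : ℤ) • v = 0 := zsmul_galH1Torsion_eq_zero W (lvl M) v
              rwa [Nat.cast_pow] at h
            torsion₂ := fun v ↦ by
              have h : ((2 ^ M : ℕ) : ℤ) • v = 0 := zsmul_galH1Torsion_eq_zero (twin W K) (lvl M) v
              rwa [Nat.cast_pow] at h
            Sel₁ := selmerGroup W (lvl M)
            Sel₂ := selmerGroup (twin W K) (lvl M)
            Loc₁ := loc₁ W M
            Loc₂ := loc₂ W K M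
            mem_sel_iff₁ := fun s ↦ by rw [mem_selmerGroup_iff, Sum.forall]; rfl
            mem_sel_iff₂ := fun s ↦ by rw [mem_selmerGroup_iff, Sum.forall]; rfl
            Kol := fun ℓ ↦ IsKolyvaginPrime N W K 2 ℓ ∧ FrobEqFrobInfty W K (2 ^ (M + 1)) ℓ ∧ kolPrime W K M ℓ
            prime_of_kol := fun _ h ↦ h.1.prime
            pl := pl
            Dv := Dv
            dv_iff := fun ℓ hℓK v ↦ by
              have hℓ := hℓK.1.prime
              rw [pl_of_prime hℓ]
              cases v with
              | inl v =>
                rw [Sum.inl.injEq]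
                exact natCast_prime_mem_iff_eq hℓ v
              | inr w => exact ⟨fun h ↦ h.elim, fun h ↦ Sum.inr_ne_inl h⟩
            dv_mul := fun ℓ ℓ' _ _ v h ↦ by
              cases v with
              | inl v => exact natCast_mem_or_natCast_mem_of_mul_mem h
              | inr w => exact h.elim
            A₁ := a₁ W M
            A₂ := a₂ W K M
            x := torsionH1ZSMul W 2 (lvl_succ_dvd M) ξ
            x_mem := torsionH1ZSMul_mem_selmerGroup_of_resTorsion_eq_kummer W M hdiv' hK.1 hξ
            x_ord := zsmul_torsionH1ZSMul_ne_zero W M hdiv' hdivM h2t hM hξ hx₀ hnd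
            M₀ := M₀
            c₁ := fun m ↦ torsionH1ZSMul W 2 (lvl_succ_dvd M) (U m)
            c₂ := fun m ↦ torsionH1ZSMul (twin W K) 2 (lvl_succ_dvd M) (Y m)
            c_one := by rw [hU1, map_zsmul]
            c_mem_loc₁ := fun n hn hev v hv ↦
              torsionH1ZSMul_mem_loc₁_of_notDv W (sigmaQ K hK.1 hθ hd) M hdiv' D' hK hn (hU' n hn hev) v hv
            c_mem_loc₂ := fun n hn ho v hv ↦
              torsionH1ZSMul_twin_mem_loc₂_of_notDv W (sigmaQ K hK.1 hθ hd) M hdiv' D' hθ hd hK hn (hY' n hn ho) v hv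
            c_mem_loc_iff₁₂ := fun ℓ m hℓ hℓm hev a ↦ by
              obtain ⟨hm, -, hcard⟩ := KolyvaginPairDataTwo.kolSupp_of_mul W (M + 1) hℓ hℓm
              have ho : Odd (ℓ * m).primeFactors.card := by rw [hcard]; exact hev.add_one
              exact zsmul_torsionH1ZSMul_twin_mem_loc₂_iff_mem_a₁ W (sigmaQ K hK.1 hθ hd) M hdiv' hθ hd D' hK.1 hK hodd hΔ hP hM hℓ hℓ.2.2
                hℓm (hU' m hm hev) (hY' (ℓ * m) hℓm ho) a
            c_mem_loc_iff₂₁ := fun ℓ m hℓ hℓm ho a ↦ by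
              obtain ⟨hm, -, hcard⟩ := KolyvaginPairDataTwo.kolSupp_of_mul W (M + 1) hℓ hℓm
              have hev : Even (ℓ * m).primeFactors.card := by rw [hcard]; exact ho.add_one
              exact zsmul_torsionH1ZSMul_mem_loc₁_iff_twin_mem_a₂ W (sigmaQ K hK.1 hθ hd) M hdiv' hθ hd D' hK.1 hK hodd hΔ hP hM hℓ hℓ.2.2
                hℓm (hU' (ℓ * m) hℓm hev) (hY' m hm ho) a },
    rfl, rfl, rfl, rfl, rfl, rfl, rfl, rfl, rfl, rfl, fun _ ↦ Iff.rfl, rfl, ?_, ?_⟩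
  · exact resTorsion_torsionH1ZSMul_eq_kummer W M hdiv' hdivM hξ
  · exact torsionH1ToH1_torsionH1ZSMul_eq_zero W M hdiv' hK.1 hξ

/-- **THE TWO-MEMBER DESCENT DATA ON THE `ℚ`-PAIR, BRANCH `ε = −1` (twin first; `w(E/ℚ) = +1`)** — the members exchanged:
`V₁ = H¹(ℚ, E^{(d_K)}[2^M])` carries the Heegner class and the even-depth classes. [cite: Kolyvagin1989Izv, §3 (the pair (E, E^D) over ℚ at l = 2)]
[cite: McCallumLMS1991, §§4–5 (Lemma 4.3, Prop. 4.4, Lemma 5.1)] [cite: GrossLMS1991, (4.4), Props. 5.3, 5.4 (2), 6.2] -/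
theorem exists_pairDataM_twin_of_pointSystem [NeZero N] [W.IsElliptic] [W.IsGloballyMinimal] [(twin W K).IsElliptic]
    (hK : IsImaginaryQuadratic K) (hodd : Odd (NumberField.discr K)) (hΔ : W.Δ < 0)
    {θ : K} (hθ : θ ∉ Set.range (algebraMap ℚ K)) (hd : θ ^ 2 = algebraMap ℚ K ((NumberField.discr K : ℤ) : ℚ))
    {P : (W.baseChange K).toAffine.Point} (hP : IsHeegnerPoint N W K P) (hM : 1 ≤ M)
    (D' : PointSystem N W K P 2 (kolPrime W K M) (M + 1) hdiv' (sigmaQ K hK.1 hθ hd)) (hε : D'.ε = -1)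
    (hL : ∀ Q : (W.baseChange K).toAffine.Point, (lvl (M + 1) : ℤ) • Q = 0 → Q = 0)
    (h2t : ∀ T : (W.baseChange K).toAffine.Point, (2 : ℤ) • T = 0 → T = 0)
    {x₀ : (W.baseChange K).toAffine.Point} {M₀ : ℕ} (hx₀ : (((2 : ℕ) : ℤ) ^ M₀) • x₀ = P)
    (hnd : ∀ Q : (W.baseChange K).toAffine.Point, (((2 : ℕ) : ℤ) ^ (M₀ + 1)) • Q ≠ P) :
    ∃ D : PairDataM (galH1Torsion (twin W K) (lvl M)) (galH1Torsion W (lvl M))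
        (HeightOneSpectrum (𝓞 ℚ) ⊕ InfinitePlace ℚ),
      D.p = 2 ∧ D.M = M ∧ D.Sel₁ = selmerGroup (twin W K) (lvl M) ∧ D.Sel₂ = selmerGroup W (lvl M) ∧
      D.Loc₁ = loc₂ W K M ∧ D.Loc₂ = loc₁ W M ∧ D.A₁ = a₂ W K M ∧ D.A₂ = a₁ W M ∧ D.pl = pl ∧ D.Dv = Dv ∧
      (∀ ℓ, D.Kol ℓ ↔ IsKolyvaginPrime N W K 2 ℓ ∧ FrobEqFrobInfty W K (2 ^ (M + 1)) ℓ ∧ kolPrime W K M ℓ) ∧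
      D.M₀ = M₀ ∧
      hPsiKT W K hθ hd (lvl M) (resTorsion (twin W K) K (lvl M) D.x) = kummerMapTorsion (W.baseChange K) (lvl M) hdivM x₀ ∧
      torsionH1ToH1 (twin W K) (lvl M) D.x = 0 := by
  have htor : IsOfFinAddOrder (Affine.Point.map (W' := W) (sigmaQ K hK.1 hθ hd : K →ₐ[ℚ] K) P - (-1 : ℤ) • P) := by
    have h := D'.conj_sub_torsion
    rwa [hε] at h
  obtain ⟨y, hy⟩ := exists_hPsiKT_resTorsion_eq_kummerMapTorsion W M hdiv' hK.1 hθ hd hL h2t hx₀ htor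
  obtain ⟨U, Y, hU, hY⟩ := exists_descent_functions W M hdiv' hK.1 hθ hd D' hL
  have hU' : ∀ m, KolSupp (fun ℓ ↦ IsKolyvaginPrime N W K 2 ℓ ∧ FrobEqFrobInfty W K (2 ^ (M + 1)) ℓ ∧ kolPrime W K M ℓ) m →
      Odd m.primeFactors.card → resTorsion W K (lvl (M + 1)) (U m) = cK W (sigmaQ K hK.1 hθ hd) (M + 1) hdiv' D' m :=
    fun m hm ho ↦ hU m hm (by rw [sign_of_odd ho, hε]; norm_num)
  have hY' : ∀ m, KolSupp (fun ℓ ↦ IsKolyvaginPrime N W K 2 ℓ ∧ FrobEqFrobInfty W K (2 ^ (M + 1)) ℓ ∧ kolPrime W K M ℓ) m →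
      Even m.primeFactors.card →
        hPsiKT W K hθ hd (lvl (M + 1)) (resTorsion (twin W K) K (lvl (M + 1)) (Y m)) = cK W (sigmaQ K hK.1 hθ hd) (M + 1) hdiv' D' m :=
    fun m hm he ↦ hY m hm (by rw [sign_of_even he, hε])
  have hY1 : Y 1 = (((2 : ℕ) : ℤ) ^ M₀) • y := by
    have h1 := hY' 1 (kolSupp_one _) (by simp)
    rw [cK_one_eq_kummerMapTorsion] at h1
    exact eq_zsmul_of_hPsiKT_resTorsion_eq W M hdiv' hK.1 hθ hd hL hx₀ h1 hy
  refine ⟨{ p := 2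
            hp := Nat.prime_two
            M := M
            torsion₁ := fun v ↦ by
              have h : ((2 ^ M : ℕ) : ℤ) • v = 0 := zsmul_galH1Torsion_eq_zero (twin W K) (lvl M) v
              rwa [Nat.cast_pow] at h
            torsion₂ := fun v ↦ by
              have h : ((2 ^ M : ℕ) : ℤ) • v = 0 := zsmul_galH1Torsion_eq_zero W (lvl M) v
              rwa [Nat.cast_pow] at h
            Sel₁ := selmerGroup (twin W K) (lvl M)
            Sel₂ := selmerGroup W (lvl M)
            Loc₁ := loc₂ W K M
            Loc₂ := loc₁ W M
            mem_sel_iff₁ := fun s ↦ by rw [mem_selmerGroup_iff, Sum.forall]; rfl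
            mem_sel_iff₂ := fun s ↦ by rw [mem_selmerGroup_iff, Sum.forall]; rfl
            Kol := fun ℓ ↦ IsKolyvaginPrime N W K 2 ℓ ∧ FrobEqFrobInfty W K (2 ^ (M + 1)) ℓ ∧ kolPrime W K M ℓ
            prime_of_kol := fun _ h ↦ h.1.prime
            pl := pl
            Dv := Dv
            dv_iff := fun ℓ hℓK v ↦ by
              have hℓ := hℓK.1.prime
              rw [pl_of_prime hℓ]
              cases v with
              | inl v =>
                rw [Sum.inl.injEq]
                exact natCast_prime_mem_iff_eq hℓ v
              | inr w => exact ⟨fun h ↦ h.elim, fun h ↦ Sum.inr_ne_inl h⟩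
            dv_mul := fun ℓ ℓ' _ _ v h ↦ by
              cases v with
              | inl v => exact natCast_mem_or_natCast_mem_of_mul_mem h
              | inr w => exact h.elim
            A₁ := a₂ W K M
            A₂ := a₁ W M
            x := torsionH1ZSMul (twin W K) 2 (lvl_succ_dvd M) y
            x_mem := torsionH1ZSMul_twin_mem_selmerGroup_of_hPsiKT_resTorsion_eq_kummer W M hdiv' hθ hd hK.1 hy
            x_ord := zsmul_torsionH1ZSMul_twin_ne_zero W M hdiv' hθ hd hdivM h2t hM hy hx₀ hnd
            M₀ := M₀
            c₁ := fun m ↦ torsionH1ZSMul (twin W K) 2 (lvl_succ_dvd M) (Y m)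
            c₂ := fun m ↦ torsionH1ZSMul W 2 (lvl_succ_dvd M) (U m)
            c_one := by rw [hY1, map_zsmul]
            c_mem_loc₁ := fun n hn hev v hv ↦
              torsionH1ZSMul_twin_mem_loc₂_of_notDv W (sigmaQ K hK.1 hθ hd) M hdiv' D' hθ hd hK hn (hY' n hn hev) v hv
            c_mem_loc₂ := fun n hn ho v hv ↦
              torsionH1ZSMul_mem_loc₁_of_notDv W (sigmaQ K hK.1 hθ hd) M hdiv' D' hK hn (hU' n hn ho) v hv
            c_mem_loc_iff₁₂ := fun ℓ m hℓ hℓm hev a ↦ by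
              obtain ⟨hm, -, hcard⟩ := KolyvaginPairDataTwo.kolSupp_of_mul W (M + 1) hℓ hℓm
              have ho : Odd (ℓ * m).primeFactors.card := by rw [hcard]; exact hev.add_one
              exact zsmul_torsionH1ZSMul_mem_loc₁_iff_twin_mem_a₂ W (sigmaQ K hK.1 hθ hd) M hdiv' hθ hd D' hK.1 hK hodd hΔ hP hM hℓ hℓ.2.2
                hℓm (hU' (ℓ * m) hℓm ho) (hY' m hm hev) a
            c_mem_loc_iff₂₁ := fun ℓ m hℓ hℓm ho a ↦ by
              obtain ⟨hm, -, hcard⟩ := KolyvaginPairDataTwo.kolSupp_of_mul W (M + 1) hℓ hℓm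
              have hev : Even (ℓ * m).primeFactors.card := by rw [hcard]; exact ho.add_one
              exact zsmul_torsionH1ZSMul_twin_mem_loc₂_iff_mem_a₁ W (sigmaQ K hK.1 hθ hd) M hdiv' hθ hd D' hK.1 hK hodd hΔ hP hM hℓ hℓ.2.2
                hℓm (hU' m hm ho) (hY' (ℓ * m) hℓm hev) a },
    rfl, rfl, rfl, rfl, rfl, rfl, rfl, rfl, rfl, rfl, fun _ ↦ Iff.rfl, rfl, ?_, ?_⟩
  · exact hPsiKT_resTorsion_torsionH1ZSMul_eq_kummer W M hdiv' hdivM hθ hd hy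
  · exact torsionH1ToH1_torsionH1ZSMul_twin_eq_zero W M hdiv' hθ hd hK.1 hy

end Summit.BirchSwinnertonDyer.BirchSwinnertonDyer.Theorems.KolyvaginPairSupplyTwo

end
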